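import Mathlib
import Summits.Ventures.PercRepro2.Defs
import Summits.Ventures.PercRepro2.Independence
import Summits.Ventures.PercRepro2.Harris
import Summits.Ventures.PercRepro2.Graph
import Summits.Ventures.PercRepro2.Exploration
import Summits.Ventures.PercRepro2.Events
import Summits.Ventures.PercRepro2.FourFunctions
import Summits.Ventures.PercRepro2.Induced
import Summits.Ventures.PercRepro2.Frontier
import Summits.Ventures.PercRepro2.ObsIndependence
import Summits.Ventures.PercRepro2.BHK
import Summits.Ventures.PercRepro2.BHKEvents
import Summits.Ventures.PercRepro2.OrderPreservation
import Summits.Ventures.PercRepro2.BHKAvoid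
import Summits.Ventures.PercRepro2.SameClusterAvoid
import Summits.Ventures.PercRepro2.CaseOneRegime
import Summits.Ventures.PercRepro2.CaseOnePos
import Summits.Ventures.PercRepro2.CaseOneJ11
import Summits.Ventures.PercRepro2.CaseOneRV

/-!
# The pendant-`a₃` class: `(i)` and `(ii) = (RV)` are theorems when `a₃` is a leaf at `a₁`
(blind cell PercRepro2, p1 g13; S5 §2.1 (K7); mine-a g11 MINE-A.md §54.11 «first brick» — the
`(DOM-D)` form for every up-set; here the `(i)` / `(ii)` rows themselves, in the kernel)

Let `e₀` be the only edge at `a₃`, joining it to `a₁` (`IsLeafAt`), and let `o, b, a₂ ≠ a₃`. Then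
* `a₃ ∈ C₁ ⟺ e₀ open` (`connEvent_leaf_eq_openEdge`), and every connection event between vertices
  `≠ a₃` ignores the state of `e₀` (`conn_iff_update_of_leaf`: a leaf lies on no path between other
  vertices — the closure lemma `mem_of_conn_of_closed`);
* hence, for an observable `f` that ignores `e₀`, `E[f · 1[e₀ open]] = p(e₀) · E[f]`
  (`expect_mul_openEdge_of_ignore`, from the pinning identities `expect_eq_pin`,
  `expect_update_one/zero`);
* so the cleared `(ii)` collapses: **`iiExpr = p(e₀) · D · [P(Q) P(Q, b, o ∈ C₂) − P(Q, b ∈ C₂) P(Q, o ∈ C₂)]`**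
  (`iiExpr_eq_of_leaf`), which is `≥ 0` by BHK 1.3 (`bhk_same_cluster_events`) — **`zSplitII_of_leaf`**,
  **`rv_of_leaf`**; and **`iExpr = p(e₀) · D · [P(Q, b ∈ C₁) P(Q, o ∈ C₂) − P(Q) P(Q, b ∈ C₁, o ∈ C₂)]`**
  (`iExpr_eq_of_leaf`), `≥ 0` by BHK 1.4 (`bhk_cross_cluster`) — **`zSplitI_of_leaf`**; with
  `jOneOne_of_i_of_ii`: **`jOneOne_of_leaf`**.
The class is the one where the required-vertex conditioning `{a₃ ∈ C₁}` is independent of the rest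
of the configuration; nothing beyond it is claimed. -/

namespace Summit.Ventures.PercRepro2

namespace CaseOne

/-! ## A leaf lies on no path between other vertices -/

section Leaf
variable {V : Type*} {E : Type*} [DecidableEq E]

/-- `a₃` is a leaf at `a₁` through `e₀`: `e₀` joins `a₁ ≠ a₃`, and no other edge meets `a₃`. -/
structure IsLeafAt (ends : E → Sym2 V) (a₁ a₃ : V) (e₀ : E) : Prop where
  /-- the leaf edge -/
  ends_eq : ends e₀ = s(a₁, a₃)
  /-- no other edge at `a₃` -/
  unique : ∀ e, a₃ ∈ ends e → e = e₀
  /-- the leaf is not its neighbour -/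
  ne : a₁ ≠ a₃

variable {ends : E → Sym2 V} {a₁ a₃ : V} {e₀ : E}

omit [DecidableEq E] in
/-- With `e₀` closed the leaf is isolated: nothing but `a₃` is connected to `a₃`. -/
lemma eq_of_conn_leaf_of_closed (hl : IsLeafAt ends a₁ a₃ e₀) {ω : Config E} (hω : ω e₀ = false)
    {x : V} (h : Conn ends ω a₃ x) : x = a₃ := by
  have hS : ∀ y ∈ ({a₃} : Set V), ∀ z, (openGraph ends ω).Adj y z → z ∈ ({a₃} : Set V) := by
    intro y hy z hyz
    rw [Set.mem_singleton_iff] at hy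
    subst hy
    obtain ⟨_, e, he, hends⟩ := openGraph_adj.1 hyz
    have : e = e₀ := hl.unique e (by rw [hends]; exact Sym2.mem_mk_left _ _)
    rw [this, hω] at he
    exact Bool.noConfusion he
  exact mem_of_conn_of_closed hS (Set.mem_singleton a₃) h

omit [DecidableEq E] in
/-- `a₃ ∈ C₁ ⟺ e₀ open`. -/
lemma conn_leaf_iff (hl : IsLeafAt ends a₁ a₃ e₀) (ω : Config E) :
    Conn ends ω a₁ a₃ ↔ ω e₀ = true := by
  constructor
  · intro h
    by_contra hne
    have hω : ω e₀ = false := by simpa using hne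
    exact hl.ne (eq_of_conn_leaf_of_closed hl hω (conn_symm h))
  · intro h
    exact conn_of_openAdj ⟨e₀, h, hl.ends_eq⟩

omit [DecidableEq E] in
/-- `{a₃ ∈ C₁} = {e₀ open}`. -/
lemma connEvent_leaf_eq_openEdge (hl : IsLeafAt ends a₁ a₃ e₀) :
    connEvent ends a₁ a₃ = openEdge e₀ := by
  ext ω
  exact conn_leaf_iff hl ω

/-- Closing the leaf edge lowers the configuration. -/
lemma update_false_le (ω : Config E) (e : E) : Function.update ω e false ≤ ω := by
  intro e'
  by_cases h : e' = e
  · subst h; simp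
  · rw [Function.update_of_ne h]

/-- **A leaf lies on no path between other vertices**: for `u, v ≠ a₃`, the connection `u ↔ v` does
not depend on the state of `e₀`. -/
lemma conn_iff_update_of_leaf (hl : IsLeafAt ends a₁ a₃ e₀) (ω : Config E) {u v : V}
    (hu : u ≠ a₃) (hv : v ≠ a₃) :
    Conn ends ω u v ↔ Conn ends (Function.update ω e₀ false) u v := by
  set ω' := Function.update ω e₀ false with hω'
  have hω'e : ω' e₀ = false := by simp [hω']
  constructor
  · intro h
    -- the `ω'`-cluster of `u`, plus `a₃` when `a₁` is in it, is closed under `ω`-adjacency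
    let S : Set V := {x | Conn ends ω' u x} ∪ {x | x = a₃ ∧ Conn ends ω' u a₁}
    have hS : ∀ x ∈ S, ∀ y, (openGraph ends ω).Adj x y → y ∈ S := by
      intro x hx y hxy
      obtain ⟨_, e, he, hends⟩ := openGraph_adj.1 hxy
      by_cases hee : e = e₀
      · subst hee
        rw [hl.ends_eq] at hends
        rcases Sym2.eq_iff.1 hends with ⟨rfl, rfl⟩ | ⟨rfl, rfl⟩
        · -- `x = a₁`, `y = a₃`
          rcases hx with hx | hx
          · exact Or.inr ⟨rfl, hx⟩
          · exact absurd hx.1 hl.ne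
        · -- `x = a₃`, `y = a₁`
          rcases hx with hx | hx
          · exact absurd (eq_of_conn_leaf_of_closed hl hω'e (conn_symm hx)) hu
          · exact Or.inl hx.2
      · have he' : ω' e = true := by rw [hω', Function.update_of_ne hee]; exact he
        rcases hx with hx | hx
        · exact Or.inl (conn_trans hx (conn_of_openAdj ⟨e, he', hends⟩))
        · exact absurd (hl.unique e (by rw [hends, hx.1]; exact Sym2.mem_mk_left _ _)) hee
    have hu' : u ∈ S := Or.inl (conn_refl ends ω' u)
    rcases mem_of_conn_of_closed hS hu' h with hv' | hv'
    · exact hv'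
    · exact absurd hv'.1 hv
  · intro h
    exact conn_mono (update_false_le ω e₀) h

/-- The connection indicator between vertices `≠ a₃` ignores the leaf edge. -/
lemma connEvent_indicator_update_of_leaf {R : Type*} [CommRing R] (hl : IsLeafAt ends a₁ a₃ e₀)
    (ω : Config E) (c : Bool) {u v : V} (hu : u ≠ a₃) (hv : v ≠ a₃) :
    (connEvent ends u v).indicator (1 : Config E → R) (Function.update ω e₀ c) =
      (connEvent ends u v).indicator 1 ω := by
  have key : ∀ ω₁ ω₂ : Config E, Function.update ω₁ e₀ false = Function.update ω₂ e₀ false →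
      ((connEvent ends u v).indicator (1 : Config E → R) ω₁ =
        (connEvent ends u v).indicator 1 ω₂) := by
    intro ω₁ ω₂ h12
    have h1 := conn_iff_update_of_leaf hl ω₁ hu hv
    have h2 := conn_iff_update_of_leaf hl ω₂ hu hv
    rw [h12] at h1
    by_cases hc : Conn ends ω₂ u v
    · rw [Set.indicator_of_mem (show ω₁ ∈ connEvent ends u v from h1.2 (h2.1 hc)),
        Set.indicator_of_mem (show ω₂ ∈ connEvent ends u v from hc)]
      simp
    · rw [Set.indicator_of_notMem (show ω₁ ∉ connEvent ends u v from fun h => hc (h2.2 (h1.1 h))),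
        Set.indicator_of_notMem (show ω₂ ∉ connEvent ends u v from hc)]
  exact key _ _ (by simp)

end Leaf

/-! ## Pinning an ignored edge -/

section Pin
variable {E : Type*} [Fintype E] [DecidableEq E] {R : Type*} [CommRing R]

/-- **`E[f · 1[e open]] = p(e) · E[f]` when `f` ignores the edge `e`.** -/
lemma expect_mul_openEdge_of_ignore (p : E → R) (e : E) (f : Config E → R)
    (hf : ∀ ω c, f (Function.update ω e c) = f ω) :
    expect p (fun ω => f ω * (openEdge e).indicator 1 ω) = p e * expect p f := by
  rw [expect_eq_pin p _ e, expect_update_one, expect_update_zero]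
  have h1 : expect p (fun ω => f (Function.update ω e true) *
      (openEdge e).indicator (1 : Config E → R) (Function.update ω e true)) = expect p f := by
    unfold expect
    refine Finset.sum_congr rfl fun ω _ => ?_
    show weight p ω * (f (Function.update ω e true) *
      (openEdge e).indicator (1 : Config E → R) (Function.update ω e true)) = weight p ω * f ω
    rw [hf, Set.indicator_of_mem (show Function.update ω e true ∈ openEdge e by simp [openEdge])]
    simp
  have h0 : expect p (fun ω => f (Function.update ω e false) *
      (openEdge e).indicator (1 : Config E → R) (Function.update ω e false)) = 0 := by
    unfold expect
    refine Finset.sum_eq_zero fun ω _ => ?_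
    show weight p ω * (f (Function.update ω e false) *
      (openEdge e).indicator (1 : Config E → R) (Function.update ω e false)) = 0
    rw [Set.indicator_of_notMem (show Function.update ω e false ∉ openEdge e by simp [openEdge])]
    simp
  rw [h1, h0]
  ring

end Pin

/-! ## The collapse of `(i)` and `(ii)` -/

section Collapse
variable {V : Type*} {E : Type*} [Fintype E] [DecidableEq E] {R : Type*} [CommRing R]
variable {ends : E → Sym2 V} {a₁ a₃ : V} {e₀ : E}

/-- **`(ii)` collapses when `a₃` is a leaf at `a₁`**:
`iiExpr = p(e₀) · D · [P(Q) P(Q, b, o ∈ C₂) − P(Q, b ∈ C₂) P(Q, o ∈ C₂)]`. -/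
theorem iiExpr_eq_of_leaf (p : E → R) (hl : IsLeafAt ends a₁ a₃ e₀) (o a₂ b : V)
    (ho : o ≠ a₃) (h2 : a₂ ≠ a₃) (hb : b ≠ a₃) :
    iiExpr p ends o a₁ a₂ a₃ b = p e₀ * Dpd p ends a₁ a₂ a₃ *
      (prob p (connEvent ends a₁ a₂)ᶜ *
          prob p (connEvent ends a₂ b ∩ connEvent ends a₂ o ∩ (connEvent ends a₁ a₂)ᶜ) -
        prob p (connEvent ends a₂ b ∩ (connEvent ends a₁ a₂)ᶜ) *
          prob p (connEvent ends a₂ o ∩ (connEvent ends a₁ a₂)ᶜ)) := by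
  unfold iiExpr zFun
  rw [connEvent_leaf_eq_openEdge hl]
  set D := Dpd p ends a₁ a₂ a₃
  set Do := Dpdo p ends o a₁ a₂ a₃
  have e1 : expect p (fun ω => (connEvent ends a₂ b).indicator (1 : Config E → R) ω *
      ((openEdge e₀).indicator 1 ω * (D * (connEvent ends a₂ o).indicator 1 ω - Do)) *
      ((connEvent ends a₁ a₂)ᶜ).indicator 1 ω) =
      p e₀ * (D * prob p (connEvent ends a₂ b ∩ connEvent ends a₂ o ∩ (connEvent ends a₁ a₂)ᶜ) -
        Do * prob p (connEvent ends a₂ b ∩ (connEvent ends a₁ a₂)ᶜ)) := by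
    have : (fun ω => (connEvent ends a₂ b).indicator (1 : Config E → R) ω *
        ((openEdge e₀).indicator 1 ω * (D * (connEvent ends a₂ o).indicator 1 ω - Do)) *
        ((connEvent ends a₁ a₂)ᶜ).indicator 1 ω) =
        fun ω => ((connEvent ends a₂ b).indicator (1 : Config E → R) ω *
          (D * (connEvent ends a₂ o).indicator 1 ω - Do) *
          ((connEvent ends a₁ a₂)ᶜ).indicator 1 ω) * (openEdge e₀).indicator 1 ω := by
      funext ω; ring
    rw [this, expect_mul_openEdge_of_ignore p e₀ _ (fun ω c => by
      simp only [Set.indicator_compl, Pi.one_apply, Pi.sub_apply]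
      rw [connEvent_indicator_update_of_leaf hl ω c h2 hb,
        connEvent_indicator_update_of_leaf hl ω c h2 ho,
        connEvent_indicator_update_of_leaf hl ω c hl.ne h2])]
    rw [expect_mul_affine]
    simp only [expect_ind3, expect_ind2]
  have e2 : expect p (fun ω => (openEdge e₀).indicator (1 : Config E → R) ω *
      (D * (connEvent ends a₂ o).indicator 1 ω - Do) * ((connEvent ends a₁ a₂)ᶜ).indicator 1 ω) =
      p e₀ * (D * prob p (connEvent ends a₂ o ∩ (connEvent ends a₁ a₂)ᶜ) -
        Do * prob p (connEvent ends a₁ a₂)ᶜ) := by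
    have : (fun ω => (openEdge e₀).indicator (1 : Config E → R) ω *
        (D * (connEvent ends a₂ o).indicator 1 ω - Do) * ((connEvent ends a₁ a₂)ᶜ).indicator 1 ω) =
        fun ω => ((D * (connEvent ends a₂ o).indicator (1 : Config E → R) ω - Do) *
          ((connEvent ends a₁ a₂)ᶜ).indicator 1 ω) * (openEdge e₀).indicator 1 ω := by
      funext ω; ring
    rw [this, expect_mul_openEdge_of_ignore p e₀ _ (fun ω c => by
      simp only [Set.indicator_compl, Pi.one_apply, Pi.sub_apply]
      rw [connEvent_indicator_update_of_leaf hl ω c h2 ho,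
        connEvent_indicator_update_of_leaf hl ω c hl.ne h2])]
    rw [expect_affine]
    simp only [expect_ind2, ← prob_eq_expect_indicator]
  rw [e1, e2, expect_ind2]
  ring

/-- **`(i)` collapses when `a₃` is a leaf at `a₁`**:
`iExpr = p(e₀) · D · [P(Q, b ∈ C₁) P(Q, o ∈ C₂) − P(Q) P(Q, b ∈ C₁, o ∈ C₂)]`. -/
theorem iExpr_eq_of_leaf (p : E → R) (hl : IsLeafAt ends a₁ a₃ e₀) (o a₂ b : V)
    (ho : o ≠ a₃) (h2 : a₂ ≠ a₃) (hb : b ≠ a₃) :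
    iExpr p ends o a₁ a₂ a₃ b = p e₀ * Dpd p ends a₁ a₂ a₃ *
      (prob p (connEvent ends a₁ b ∩ (connEvent ends a₁ a₂)ᶜ) *
          prob p (connEvent ends a₂ o ∩ (connEvent ends a₁ a₂)ᶜ) -
        prob p (connEvent ends a₁ a₂)ᶜ *
          prob p (connEvent ends a₁ b ∩ connEvent ends a₂ o ∩ (connEvent ends a₁ a₂)ᶜ)) := by
  unfold iExpr zFun
  rw [connEvent_leaf_eq_openEdge hl]
  set D := Dpd p ends a₁ a₂ a₃
  set Do := Dpdo p ends o a₁ a₂ a₃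
  have e1 : expect p (fun ω => (connEvent ends a₁ b).indicator (1 : Config E → R) ω *
      ((openEdge e₀).indicator 1 ω * (D * (connEvent ends a₂ o).indicator 1 ω - Do)) *
      ((connEvent ends a₁ a₂)ᶜ).indicator 1 ω) =
      p e₀ * (D * prob p (connEvent ends a₁ b ∩ connEvent ends a₂ o ∩ (connEvent ends a₁ a₂)ᶜ) -
        Do * prob p (connEvent ends a₁ b ∩ (connEvent ends a₁ a₂)ᶜ)) := by
    have : (fun ω => (connEvent ends a₁ b).indicator (1 : Config E → R) ω *
        ((openEdge e₀).indicator 1 ω * (D * (connEvent ends a₂ o).indicator 1 ω - Do)) *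
        ((connEvent ends a₁ a₂)ᶜ).indicator 1 ω) =
        fun ω => ((connEvent ends a₁ b).indicator (1 : Config E → R) ω *
          (D * (connEvent ends a₂ o).indicator 1 ω - Do) *
          ((connEvent ends a₁ a₂)ᶜ).indicator 1 ω) * (openEdge e₀).indicator 1 ω := by
      funext ω; ring
    rw [this, expect_mul_openEdge_of_ignore p e₀ _ (fun ω c => by
      simp only [Set.indicator_compl, Pi.one_apply, Pi.sub_apply]
      rw [connEvent_indicator_update_of_leaf hl ω c hl.ne hb,
        connEvent_indicator_update_of_leaf hl ω c h2 ho,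
        connEvent_indicator_update_of_leaf hl ω c hl.ne h2])]
    rw [expect_mul_affine]
    simp only [expect_ind3, expect_ind2]
  have e2 : expect p (fun ω => (openEdge e₀).indicator (1 : Config E → R) ω *
      (D * (connEvent ends a₂ o).indicator 1 ω - Do) * ((connEvent ends a₁ a₂)ᶜ).indicator 1 ω) =
      p e₀ * (D * prob p (connEvent ends a₂ o ∩ (connEvent ends a₁ a₂)ᶜ) -
        Do * prob p (connEvent ends a₁ a₂)ᶜ) := by
    have : (fun ω => (openEdge e₀).indicator (1 : Config E → R) ω *
        (D * (connEvent ends a₂ o).indicator 1 ω - Do) * ((connEvent ends a₁ a₂)ᶜ).indicator 1 ω) =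
        fun ω => ((D * (connEvent ends a₂ o).indicator (1 : Config E → R) ω - Do) *
          ((connEvent ends a₁ a₂)ᶜ).indicator 1 ω) * (openEdge e₀).indicator 1 ω := by
      funext ω; ring
    rw [this, expect_mul_openEdge_of_ignore p e₀ _ (fun ω c => by
      simp only [Set.indicator_compl, Pi.one_apply, Pi.sub_apply]
      rw [connEvent_indicator_update_of_leaf hl ω c h2 ho,
        connEvent_indicator_update_of_leaf hl ω c hl.ne h2])]
    rw [expect_affine]
    simp only [expect_ind2, ← prob_eq_expect_indicator]
  rw [e1, e2, expect_ind2]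
  ring

end Collapse

/-! ## The theorems -/

section Theorems
variable {V : Type*} {E : Type*} [Fintype E] [DecidableEq E] [Fintype V] [DecidableEq V]
  {R : Type*} [CommRing R] [LinearOrder R] [IsStrictOrderedRing R]
variable {ends : E → Sym2 V} {a₁ a₃ : V} {e₀ : E}

/-- BHK 1.3 for the events `{b ∈ C₂}`, `{o ∈ C₂}` under `Q`. -/
lemma bhk_same_Q (p : E → R) (hp : IsProbVec p) (ends : E → Sym2 V) (o a₁ a₂ b : V) :
    prob p (connEvent ends a₂ b ∩ (connEvent ends a₁ a₂)ᶜ) *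
        prob p (connEvent ends a₂ o ∩ (connEvent ends a₁ a₂)ᶜ) ≤
      prob p (connEvent ends a₂ b ∩ connEvent ends a₂ o ∩ (connEvent ends a₁ a₂)ᶜ) *
        prob p (connEvent ends a₁ a₂)ᶜ := by
  have h := bhk_same_cluster_events p hp ends a₂ a₁ (isUpperSet_mem_setOf b) (isUpperSet_mem_setOf o)
  rw [← connEvent_eq_clusterInEvent ends a₂ b, ← connEvent_eq_clusterInEvent ends a₂ o,
    connEvent_comm ends a₂ a₁] at h
  exact h

/-- BHK 1.4 for the events `{b ∈ C₁}`, `{o ∈ C₂}` under `Q`. -/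
lemma bhk_cross_Q (p : E → R) (hp : IsProbVec p) (ends : E → Sym2 V) (o a₁ a₂ b : V) :
    prob p (connEvent ends a₁ b ∩ connEvent ends a₂ o ∩ (connEvent ends a₁ a₂)ᶜ) *
        prob p (connEvent ends a₁ a₂)ᶜ ≤
      prob p (connEvent ends a₁ b ∩ (connEvent ends a₁ a₂)ᶜ) *
        prob p (connEvent ends a₂ o ∩ (connEvent ends a₁ a₂)ᶜ) := by
  have h := bhk_cross_cluster p hp ends a₁ a₂ (isUpperSet_mem_setOf b) (isUpperSet_mem_setOf o)
  rw [← connEvent_eq_clusterInEvent ends a₁ b, ← connEvent_eq_clusterInEvent ends a₂ o] at h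
  exact h

/-- **`(ii)` holds when `a₃` is a leaf at `a₁`** (`o, a₂, b ≠ a₃`). -/
theorem zSplitII_of_leaf (p : E → R) (hp : IsProbVec p) (hl : IsLeafAt ends a₁ a₃ e₀) (o a₂ b : V)
    (ho : o ≠ a₃) (h2 : a₂ ≠ a₃) (hb : b ≠ a₃) : ZSplitII p ends o a₁ a₂ a₃ b := by
  unfold ZSplitII
  rw [iiExpr_eq_of_leaf p hl o a₂ b ho h2 hb]
  refine mul_nonneg (mul_nonneg (hp.nonneg e₀) (prob_nonneg hp _)) ?_
  have h := bhk_same_Q p hp ends o a₁ a₂ b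
  linarith

/-- **`(RV)` holds when `a₃` is a leaf at `a₁`** (`o, a₂, b ≠ a₃`). -/
theorem rv_of_leaf (p : E → R) (hp : IsProbVec p) (hl : IsLeafAt ends a₁ a₃ e₀) (o a₂ b : V)
    (ho : o ≠ a₃) (h2 : a₂ ≠ a₃) (hb : b ≠ a₃) : RV p ends o a₁ a₂ a₃ b := by
  unfold RV
  rw [rvExpr_eq]
  exact mul_nonneg (prob_nonneg hp _) (zSplitII_of_leaf p hp hl o a₂ b ho h2 hb)

/-- **`(i)` holds when `a₃` is a leaf at `a₁`** (`o, a₂, b ≠ a₃`). -/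
theorem zSplitI_of_leaf (p : E → R) (hp : IsProbVec p) (hl : IsLeafAt ends a₁ a₃ e₀) (o a₂ b : V)
    (ho : o ≠ a₃) (h2 : a₂ ≠ a₃) (hb : b ≠ a₃) : ZSplitI p ends o a₁ a₂ a₃ b := by
  unfold ZSplitI
  rw [iExpr_eq_of_leaf p hl o a₂ b ho h2 hb]
  refine mul_nonneg (mul_nonneg (hp.nonneg e₀) (prob_nonneg hp _)) ?_
  have h := bhk_cross_Q p hp ends o a₁ a₂ b
  linarith

/-- **`(J1₁)` holds when `a₃` is a leaf at `a₁`** (`o, a₂, b ≠ a₃`). -/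
theorem jOneOne_of_leaf (p : E → R) (hp : IsProbVec p) (hl : IsLeafAt ends a₁ a₃ e₀) (o a₂ b : V)
    (ho : o ≠ a₃) (h2 : a₂ ≠ a₃) (hb : b ≠ a₃) : JOneOne p ends o a₁ a₂ a₃ b :=
  jOneOne_of_i_of_ii p ends o a₁ a₂ a₃ b (zSplitI_of_leaf p hp hl o a₂ b ho h2 hb)
    (zSplitII_of_leaf p hp hl o a₂ b ho h2 hb)

end Theorems

end CaseOne

end Summit.Ventures.PercRepro2
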